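/-
Copyright (c) 2026 the pub-hodgecm-mathlib formalisation cell (harness21).  Prover seat hodgecm-mathlib-A-p06 (g28) — (R2-ram)∕ROAD W (N)-side, 2026-09-01.
ROAD W (W6-N), FILE A (the level-generic core): Kottwitz's NON-ELLIPTIC relation on `U(Φ₂)(L⁺_v)` from ANY vertex-transitive, dart-transitive action of `U₂` on a
tree with compact open stabilisers GIVEN BY MEMBERSHIP, the vertex stabiliser reading «integral one-place matrix» on diagonal elements — sibling of ★ B-p14 (g32)
`RankOneEulerPoincareNonsplitRamifiedEllipticOfTreeAction` ((W6-E)); FILE B `RankOneEulerPoincareNonsplitRamifiedNonEllipticOfTreeAction` reads it at `(K♯_D, K, K♯_D ⊓ K)`.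
-/
import Literature.NumberTheory.Rogawski1990.RankOneEulerPoincareNonsplitRamifiedPackage   -- ★ (B-p14 g32) p843499: the levels `K♯_D`, `mem_comap_map_conj_glInt_iff`, `isCompact_isOpen_comap_map_conj_glInt(_inf_cmLocalIntegralLevel)`
import Literature.NumberTheory.Automorphic.TreeActionNonEllipticOrbitalIntegral         -- ★ (F0P2-p02 g9) p843769: THEOREM C `epCombination_classOrbitalIntegral_eq_zero_of_vertexAction`
import Literature.NumberTheory.Automorphic.UnitaryGroupSplitTorusRankOne                -- ★ (A-p06 g27) p843441: `exists_splitTorus_generator_local_of_nonsplit`, `exists_valuation_apply_eq_zpow`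
import Literature.NumberTheory.Automorphic.UnitaryRankTwoRegularTorusTrichotomy          -- ★ (B-p14) `exists_conj_val_eq_glDiagonal_of_not_compactSpace_centralizer` ((g-D))
import Literature.NumberTheory.Automorphic.OrbitalMeasureCanonicalExistsCM               -- ★ `compactCore_centralizer_local_facts_of_isRegularElt`
import Literature.NumberTheory.Automorphic.UnitaryUnitOrbitalIntegralFixedPoints         -- ★ `isRegularElt_val_conj`, `isClosed_conjClass_local_of_isRegularElt`, the `U(H)(L⁺_v)` instances
import Literature.NumberTheory.Automorphic.ValuedFieldValuativeRelBridge                 -- ★ `isUniformizingElement_of_v_eq`, `isDiscreteValuationRing_integer_of_compatible`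
import HarnessLib

/-!
# The non-elliptic Euler–Poincaré relation on `U(Φ₂)(L⁺_v)` from a tree action, level-generic core (ROAD W, wild places included) — FILE A

Topic `NumberTheory/Rogawski1990`, namespace `Literature.NumberTheory.Rogawski1990`.  THEOREMS ONLY: no definition, no named fact, no instance, no notation,
no `sorry`; kernel lane.  Cell `pub/hodgecm-mathlib`, F0∕P3a, crux H413 = stmt-HodgeConjecture-24833, line «N6nsGerm», residue `stub_N6nsR2ram`; ROAD W
(MEMO `F0/P3a/F0P3a-p04/g13/MEMO-R2wild.F0P3a-p04g13.md`), brick (W6-N) (owner word B-p14 (g32) 2026-09-01T10:53:17Z; census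
`F0/P3a/A-p06/g28/CENSUS-W6N-NonEllipticOfTreeAction.A-p06g28.md`).
HONEST LABEL: HC_CM is proved only modulo the cell's remaining named inputs (hLiu418, h413) until rung 0 closes; this file is unconditional orbit counting over ★
engines and asserts nothing printed.

THE MATHEMATICS [Kottwitz1988, §2 Thm. 2 (non-elliptic case `O_γ(f_EP) = 0`); Serre1980Trees, I.6, II.1.1–1.3; Laumon1995, (5.3.2); Rogawski1990, §12.6 p. 174;
Tits1979, §2.7, §3.9].  At every ramified non-split place `w ∣ v`, `U₂ = U(Φ₂)(L⁺_v)` acts through `ρ : U(Φ₂)(E_w) → PGL₂(F_v)` on the tree `X` of `SL₂(F_v)` with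
ONE orbit of vertices and ONE orbit of darts (inversions allowed), the two stabilisers being `K = U₂ ∩ GL₂(𝒪_w)` and `K♯_D = U₂ ∩ D GL₂(𝒪_w) D⁻¹` (`D` diagonal)
in an order depending on the type of `E_w ∕ F_v`.  THIS FILE takes such an action as HYPOTHESES — exactly the binders of the elliptic sibling ★
`epEllipticRelation_vertexEdgeLevels_of_vertexAction_local` (p843743): `act : ↥U_w → W → W`, `act_one`, `act_mul`, `act_adj`, `h01`, `hV`, `hD`, and the two stabiliser
identifications `hKv`, `hKe` through the one-place model — plus ONE torus binder `hstep` («the diagonal translation `t_ϖ = diag(ϖ, (σ_w ϖ)⁻¹)` moves the base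
vertex `x₀` to a neighbour», true at a ramified place since `ρ(t_ϖ) = [diag(N ϖ, 1)]` and `ord_F N ϖ = 1`), and concludes Kottwitz's NON-ELLIPTIC relation
`((ν K♯_D).toReal : ℂ)⁻¹ Φ(⟦γ⟧, 𝟙_{K♯_D}) + ((ν K).toReal : ℂ)⁻¹ Φ(⟦γ⟧, 𝟙_K) − ((ν (K♯_D ⊓ K)).toReal : ℂ)⁻¹ Φ(⟦γ⟧, 𝟙_{K♯_D ⊓ K}) = 0` for `m` canonical and every
regular `γ ∈ U₂` with NON-COMPACT centraliser — the `hN` input of ★ `exists_epRelations_of_vertexEdgeLevels` (p843499) VERBATIM.  Route: `γ` is conjugate to a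
regular DIAGONAL `δ` (★ (g-D) `exists_conj_val_eq_glDiagonal_of_not_compactSpace_centralizer`; both sides are class functions), `Z(δ)` is the split torus with
generator `τ = e_w⁻¹ t_ϖ` modulo its compact core (★ `exists_splitTorus_generator_local_of_nonsplit`, ★ `compactCore_centralizer_local_facts_of_isRegularElt`), and ★
THEOREM C `epCombination_classOrbitalIntegral_eq_zero_of_vertexAction` (F0P2-p02 (g9)) applies once the three tree-side torus facts hold at `x₀`: `hstep` (binder),
and — DERIVED here from `hKv` for a DIAGONAL `D` — `t_ϖ^n x₀ = x₀ ⇒ n = 0` (diagonal elements of the vertex stabiliser have unit entries) and `δ x₀ = t_ϖ^k x₀`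
(`δ = t_ϖ^k · u₀` with `u₀` diagonal of unit entries, rank one ★ `exists_valuation_apply_eq_zpow`).  THIS FILE (A) is the level-generic core
`epNonEllipticCombination_eq_zero_of_vertexAction_of_levels` (levels `Kv, Ke, I ≤ U₂` given by membership; `hdiag` = «on elements with DIAGONAL one-place matrix,
`Kv`-membership is integrality of that matrix»); FILE B `RankOneEulerPoincareNonsplitRamifiedNonEllipticOfTreeAction` reads it at `(K♯_D, K, K♯_D ⊓ K)` in the two
versions `K♯_D`-vertex (`E_w = F_v(√π)`-type, all tame places) and `K`-vertex (`F_v(√u)`-type).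

## References
* [Kottwitz1988] R. E. Kottwitz, *Tamagawa numbers*, Ann. of Math. 127 (1988), 629–646, §2 Theorem 2.
* [Serre1980Trees] J.-P. Serre, *Trees* (1980), I.6.1, II.1.1–1.3.
* [Laumon1995] G. Laumon, *Cohomology of Drinfeld Modular Varieties* I (1996), Lemma (5.3.2) p. 136.
* [Rogawski1990] J. D. Rogawski, *Automorphic Representations of Unitary Groups in Three Variables* (1990), §12.6 p. 174; §3.6 pp. 31–32; §4.3 p. 43.
* [Tits1979] J. Tits, *Reductive groups over local fields*, PSPM 33.1 (1979), §2.7, §3.9.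
-/

set_option autoImplicit false

noncomputable section

open scoped ValuativeRel Matrix MatrixGroups
open Matrix ValuativeRel NumberField IsDedekindDomain MulAction MeasureTheory Measure Topology

namespace Literature.NumberTheory.Rogawski1990

open Literature.NumberTheory.Automorphic Literature.NumberTheory.Automorphic.UnitaryGroup Literature.Combinatorics.SimpleGraph
  Literature.NumberTheory.GaloisRepresentations

/-! ## §1 Two lemmas on diagonal matrices over a valued field -/

section Diagonal

variable {K : Type*} [Field K] [ValuativeRel K]

/-- A diagonal element of `GL₂(K)` lies in `D GL₂(𝒪) D⁻¹` for a DIAGONAL `D = diag(dD)` iff it lies in `GL₂(𝒪)` (diagonal matrices commute). [cite: Serre1980Trees, II.1.1] -/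
theorem mem_map_conj_glDiagonal_iff_of_diagonal (dD : Fin 2 → Kˣ) {g : GL (Fin 2) K}
    (hg : ∀ i j, i ≠ j → (g : Matrix (Fin 2) (Fin 2) K) i j = 0) :
    g ∈ (glInt 2 K).map (MulAut.conj (glDiagonal 2 K dD)).toMonoidHom ↔ g ∈ glInt 2 K := by
  -- `g` is the diagonal matrix of its diagonal entries, so it commutes with `D`
  have hgd : (g : Matrix (Fin 2) (Fin 2) K) = diagonal fun i => (g : Matrix (Fin 2) (Fin 2) K) i i := by
    ext i j
    by_cases hij : i = j
    · subst hij; rw [diagonal_apply_eq]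
    · rw [diagonal_apply_ne _ hij, hg i j hij]
  have hcomm : glDiagonal 2 K dD * g = g * glDiagonal 2 K dD := by
    apply Units.ext
    rw [Units.val_mul, Units.val_mul, coe_glDiagonal, hgd, diagonal_mul_diagonal, diagonal_mul_diagonal]
    congr 1; funext i; exact mul_comm _ _
  have hconj : (MulAut.conj (glDiagonal 2 K dD)).toMonoidHom g = g := by
    rw [MulEquiv.coe_toMonoidHom, MulAut.conj_apply, hcomm, mul_inv_cancel_right]
  constructor
  · rintro ⟨h, hh, hhg⟩
    have hh' : h = g := by
      have h1 : (MulAut.conj (glDiagonal 2 K dD)).toMonoidHom h = (MulAut.conj (glDiagonal 2 K dD)).toMonoidHom g := hhg.trans hconj.symm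
      exact (MulAut.conj (glDiagonal 2 K dD)).injective h1
    rw [← hh']; exact hh
  · intro hgi
    exact ⟨g, hgi, hconj⟩

/-- A diagonal element of `GL₂(K)` all of whose diagonal entries have valuation `1` lies in `GL₂(𝒪)`. [cite: Serre1980Trees, II.1.1] -/
theorem mem_glInt_of_diagonal_of_valuation_eq_one {g : GL (Fin 2) K}
    (hg : ∀ i j, i ≠ j → (g : Matrix (Fin 2) (Fin 2) K) i j = 0) (hv : ∀ i, valuation K ((g : Matrix (Fin 2) (Fin 2) K) i i) = 1) :
    g ∈ glInt 2 K := by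
  have hgd : (g : Matrix (Fin 2) (Fin 2) K) = diagonal fun i => (g : Matrix (Fin 2) (Fin 2) K) i i := by
    ext i j
    by_cases hij : i = j
    · subst hij; rw [diagonal_apply_eq]
    · rw [diagonal_apply_ne _ hij, hg i j hij]
  refine mem_glInt_of_isIntegralMatrix (fun i j => ?_) ?_
  · by_cases hij : i = j
    · subst hij; exact (Valuation.mem_integer_iff _ _).2 (hv i).le
    · rw [hg i j hij]; exact zero_mem _
  · rw [hgd, det_diagonal, map_prod]
    exact Finset.prod_eq_one fun i _ => hv i


/-- On `Fin 2`, `f 0 ≠ f 1` gives `f i ≠ f j` for all `i ≠ j`. [folklore] -/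
private theorem ne_apply_of_apply_zero_ne_apply_one {α : Type*} {f : Fin 2 → α} (h : f 0 ≠ f 1) :
    ∀ i j : Fin 2, i ≠ j → f i ≠ f j := by
  intro i j hij
  fin_cases i <;> fin_cases j
  · exact absurd rfl hij
  · exact h
  · exact h.symm
  · exact absurd rfl hij

end Diagonal


/-! ## §2 The level-generic core on `U₂ = U(Φ₂)(L⁺_v)` -/

section Core

variable (L : Type) [Field L] [NumberField L] [IsCMField L] {v : HeightOneSpectrum (𝓞 ↥(maximalRealSubfield L))}
  (w : PlacesOver L v) (hw : IsCMField.complexConj L • w.1 = w.1)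
  (ϖ : (w.1.adicCompletion L)ˣ) (hϖ : Valued.v (ϖ : w.1.adicCompletion L) = WithZero.exp (-1 : ℤ))
  [MeasurableSpace ((cmDatum L 2 (Matrix.of fun i j : Fin 2 => if i.val + j.val + 1 = 2 then (1 : L) else 0)).Local v)] [BorelSpace ((cmDatum L 2 (Matrix.of fun i j : Fin 2 => if i.val + j.val + 1 = 2 then (1 : L) else 0)).Local v)]
  [∀ γ : (cmDatum L 2 (Matrix.of fun i j : Fin 2 => if i.val + j.val + 1 = 2 then (1 : L) else 0)).Local v,
    MeasurableSpace (((cmDatum L 2 (Matrix.of fun i j : Fin 2 => if i.val + j.val + 1 = 2 then (1 : L) else 0)).Local v) ⧸ Subgroup.centralizer ({γ} : Set ((cmDatum L 2 (Matrix.of fun i j : Fin 2 => if i.val + j.val + 1 = 2 then (1 : L) else 0)).Local v)))]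
  [∀ γ : (cmDatum L 2 (Matrix.of fun i j : Fin 2 => if i.val + j.val + 1 = 2 then (1 : L) else 0)).Local v,
    BorelSpace (((cmDatum L 2 (Matrix.of fun i j : Fin 2 => if i.val + j.val + 1 = 2 then (1 : L) else 0)).Local v) ⧸ Subgroup.centralizer ({γ} : Set ((cmDatum L 2 (Matrix.of fun i j : Fin 2 => if i.val + j.val + 1 = 2 then (1 : L) else 0)).Local v)))]
  (ν : Measure ((cmDatum L 2 (Matrix.of fun i j : Fin 2 => if i.val + j.val + 1 = 2 then (1 : L) else 0)).Local v)) [IsHaarMeasure ν] [ν.IsMulRightInvariant]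

omit [IsCMField L] in
/-- `(Φ₂)_w = !![0, 1; 1, 0]` (entries `0, 1` under `algebraMap`; the literal of ★ `placeForm_antidiagTwo_eq`). [cite: Rogawski1990, §3.6 p. 31] -/
private theorem placeForm_antidiagTwo_eq_oneOne :
    placeForm (Matrix.of fun i j : Fin 2 => if i.val + j.val + 1 = 2 then (1 : L) else 0) w.1 = (!![0, 1; 1, 0] : Matrix (Fin 2) (Fin 2) (w.1.adicCompletion L)) := by
  ext i j
  fin_cases i <;> fin_cases j <;> simp [placeForm, Matrix.map_apply]

set_option maxHeartbeats 800000 in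
include hw hϖ in
/-- **THE LEVEL-GENERIC CORE.**  `U₂ = U(Φ₂)(L⁺_v)` acts (`act`, `act_one`, `act_mul`, `act_adj`) on a tree `X`, transitively on vertices (`hV`) and darts (`hD`);
`Kv = Stab(x₀)`, `Ke = Stab{x₀, x₁}`, `I = Stab(x₀, x₁)` compact open subgroups GIVEN BY MEMBERSHIP; on elements whose one-place matrix is DIAGONAL, membership in
`Kv` is integrality of the one-place matrix (`hdiag` — true for `Kv = K` and for `Kv = K♯_D`, `D` diagonal, §3); and the diagonal translation `t_ϖ = diag(ϖ, (σ_w ϖ)⁻¹)`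
moves `x₀` to a neighbour (`hstep`).  Then for `m` canonical and every regular `γ` with non-compact centraliser:
`((ν Kv).toReal : ℂ)⁻¹ Φ(⟦γ⟧, 𝟙_{Kv}) + ((ν Ke).toReal : ℂ)⁻¹ Φ(⟦γ⟧, 𝟙_{Ke}) − ((ν I).toReal : ℂ)⁻¹ Φ(⟦γ⟧, 𝟙_I) = 0` (★ THEOREM C at the diagonal representative `δ` of
`⟦γ⟧`, split-torus generator `τ = e_w⁻¹ t_ϖ`). [cite: Kottwitz1988, §2 Theorem 2] [cite: Serre1980Trees, I.6.1; II.1.1–1.3] [cite: Laumon1995, Lemma (5.3.2) p. 136]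
[cite: Rogawski1990, §12.6 p. 174; §3.6 pp. 31–32] [cite: Tits1979, §3.9] -/
theorem epNonEllipticCombination_eq_zero_of_vertexAction_of_levels
    {m : OrbitalMeasureFamily ((cmDatum L 2 (Matrix.of fun i j : Fin 2 => if i.val + j.val + 1 = 2 then (1 : L) else 0)).Local v)}
    (hm : m.IsCanonical (fun γ => IsRegularElt (γ.val : GL (Fin 2) (UnitaryGroup.LocalRing L v))) ν)
    {W : Type*} {X : SimpleGraph W} (hX : X.IsTree) (act : (cmDatum L 2 (Matrix.of fun i j : Fin 2 => if i.val + j.val + 1 = 2 then (1 : L) else 0)).Local v → W → W)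
    (act_one : ∀ x : W, act 1 x = x) (act_mul : ∀ (g h : (cmDatum L 2 (Matrix.of fun i j : Fin 2 => if i.val + j.val + 1 = 2 then (1 : L) else 0)).Local v) (x : W), act (g * h) x = act g (act h x))
    (act_adj : ∀ (g : (cmDatum L 2 (Matrix.of fun i j : Fin 2 => if i.val + j.val + 1 = 2 then (1 : L) else 0)).Local v) (a b : W), X.Adj (act g a) (act g b) ↔ X.Adj a b)
    {x₀ x₁ : W} (h01 : X.Adj x₀ x₁) (hV : ∀ x : W, ∃ g : (cmDatum L 2 (Matrix.of fun i j : Fin 2 => if i.val + j.val + 1 = 2 then (1 : L) else 0)).Local v, act g x₀ = x)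
    (hD : ∀ a b : W, X.Adj a b → ∃ g : (cmDatum L 2 (Matrix.of fun i j : Fin 2 => if i.val + j.val + 1 = 2 then (1 : L) else 0)).Local v, act g x₀ = a ∧ act g x₁ = b)
    (Kv Ke I : Subgroup ((cmDatum L 2 (Matrix.of fun i j : Fin 2 => if i.val + j.val + 1 = 2 then (1 : L) else 0)).Local v))
    (hKv : ∀ g : (cmDatum L 2 (Matrix.of fun i j : Fin 2 => if i.val + j.val + 1 = 2 then (1 : L) else 0)).Local v, g ∈ Kv ↔ act g x₀ = x₀)
    (hKe : ∀ g : (cmDatum L 2 (Matrix.of fun i j : Fin 2 => if i.val + j.val + 1 = 2 then (1 : L) else 0)).Local v, g ∈ Ke ↔ s(act g x₀, act g x₁) = s(x₀, x₁))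
    (hI : ∀ g : (cmDatum L 2 (Matrix.of fun i j : Fin 2 => if i.val + j.val + 1 = 2 then (1 : L) else 0)).Local v, g ∈ I ↔ act g x₀ = x₀ ∧ act g x₁ = x₁)
    (hKvo : IsOpen (Kv : Set ((cmDatum L 2 (Matrix.of fun i j : Fin 2 => if i.val + j.val + 1 = 2 then (1 : L) else 0)).Local v))) (hKvc : IsCompact (Kv : Set ((cmDatum L 2 (Matrix.of fun i j : Fin 2 => if i.val + j.val + 1 = 2 then (1 : L) else 0)).Local v)))
    (hKeo : IsOpen (Ke : Set ((cmDatum L 2 (Matrix.of fun i j : Fin 2 => if i.val + j.val + 1 = 2 then (1 : L) else 0)).Local v))) (hKec : IsCompact (Ke : Set ((cmDatum L 2 (Matrix.of fun i j : Fin 2 => if i.val + j.val + 1 = 2 then (1 : L) else 0)).Local v)))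
    (hIo : IsOpen (I : Set ((cmDatum L 2 (Matrix.of fun i j : Fin 2 => if i.val + j.val + 1 = 2 then (1 : L) else 0)).Local v))) (hIc : IsCompact (I : Set ((cmDatum L 2 (Matrix.of fun i j : Fin 2 => if i.val + j.val + 1 = 2 then (1 : L) else 0)).Local v)))
    (hdiag : ∀ g : (cmDatum L 2 (Matrix.of fun i j : Fin 2 => if i.val + j.val + 1 = 2 then (1 : L) else 0)).Local v,
      (∀ i j : Fin 2, i ≠ j → ((((localNonsplitEquiv (IsCMField.complexConj L) (Matrix.of fun i j : Fin 2 => if i.val + j.val + 1 = 2 then (1 : L) else 0)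
          (IsCMField.complexConj_ne_one L) w hw) g : ↥(unitaryGroupOfForm (galAdicCompletionMap (L := L) (IsCMField.complexConj L) hw)
            (placeForm (Matrix.of fun i j : Fin 2 => if i.val + j.val + 1 = 2 then (1 : L) else 0) w.1))) : GL (Fin 2) (w.1.adicCompletion L)) : Matrix (Fin 2) (Fin 2) (w.1.adicCompletion L)) i j = 0) →
      (g ∈ Kv ↔ (((localNonsplitEquiv (IsCMField.complexConj L) (Matrix.of fun i j : Fin 2 => if i.val + j.val + 1 = 2 then (1 : L) else 0)
          (IsCMField.complexConj_ne_one L) w hw) g : ↥(unitaryGroupOfForm (galAdicCompletionMap (L := L) (IsCMField.complexConj L) hw)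
            (placeForm (Matrix.of fun i j : Fin 2 => if i.val + j.val + 1 = 2 then (1 : L) else 0) w.1))) : GL (Fin 2) (w.1.adicCompletion L)) ∈ glInt 2 (w.1.adicCompletion L)))
    (hstep : ∀ g : (cmDatum L 2 (Matrix.of fun i j : Fin 2 => if i.val + j.val + 1 = 2 then (1 : L) else 0)).Local v,
      ((((localNonsplitEquiv (IsCMField.complexConj L) (Matrix.of fun i j : Fin 2 => if i.val + j.val + 1 = 2 then (1 : L) else 0)
          (IsCMField.complexConj_ne_one L) w hw) g : ↥(unitaryGroupOfForm (galAdicCompletionMap (L := L) (IsCMField.complexConj L) hw)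
            (placeForm (Matrix.of fun i j : Fin 2 => if i.val + j.val + 1 = 2 then (1 : L) else 0) w.1))) : GL (Fin 2) (w.1.adicCompletion L)) : Matrix (Fin 2) (Fin 2) (w.1.adicCompletion L)) =
        diagonal ![(ϖ : w.1.adicCompletion L), (galAdicCompletionMap (L := L) (IsCMField.complexConj L) hw (ϖ : w.1.adicCompletion L))⁻¹] →
      X.Adj x₀ (act g x₀))
    (γ : (cmDatum L 2 (Matrix.of fun i j : Fin 2 => if i.val + j.val + 1 = 2 then (1 : L) else 0)).Local v) (hreg : IsRegularElt (γ.val : GL (Fin 2) (UnitaryGroup.LocalRing L v)))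
    (hnc : ¬ CompactSpace (Subgroup.centralizer ({γ} : Set ((cmDatum L 2 (Matrix.of fun i j : Fin 2 => if i.val + j.val + 1 = 2 then (1 : L) else 0)).Local v)))) :
    (((ν Kv).toReal : ℂ))⁻¹ * classOrbitalIntegral m ((Kv : Set ((cmDatum L 2 (Matrix.of fun i j : Fin 2 => if i.val + j.val + 1 = 2 then (1 : L) else 0)).Local v)).indicator fun _ => (1 : ℂ)) (ConjClasses.mk γ) +
        (((ν Ke).toReal : ℂ))⁻¹ * classOrbitalIntegral m ((Ke : Set ((cmDatum L 2 (Matrix.of fun i j : Fin 2 => if i.val + j.val + 1 = 2 then (1 : L) else 0)).Local v)).indicator fun _ => (1 : ℂ)) (ConjClasses.mk γ) -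
        (((ν I).toReal : ℂ))⁻¹ * classOrbitalIntegral m ((I : Set ((cmDatum L 2 (Matrix.of fun i j : Fin 2 => if i.val + j.val + 1 = 2 then (1 : L) else 0)).Local v)).indicator fun _ => (1 : ℂ)) (ConjClasses.mk γ) = 0 := by
  haveI : Algebra.IsQuadraticExtension ↥(maximalRealSubfield L) L := IsCMField.isQuadraticExtension L
  haveI hvs : Subsingleton (PlacesOver L v) :=
    PlacesOver.subsingleton_of_smul_eq (IsCMField.complexConj L) (IsCMField.complexConj_ne_one L) w hw
  have hc1 : IsCMField.complexConj L ≠ 1 := IsCMField.complexConj_ne_one L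
  -- names for the one-place data
  set E := w.1.adicCompletion L with hEdef
  set σ : E →+* E := galAdicCompletionMap (L := L) (IsCMField.complexConj L) hw with hσdef
  set eW := (localNonsplitEquiv (IsCMField.complexConj L) (Matrix.of fun i j : Fin 2 => if i.val + j.val + 1 = 2 then (1 : L) else 0)
          (IsCMField.complexConj_ne_one L) w hw) with heW
  set φ : (cmDatum L 2 (Matrix.of fun i j : Fin 2 => if i.val + j.val + 1 = 2 then (1 : L) else 0)).Local v →* GL (Fin 2) E :=
    (unitaryGroupOfForm (galAdicCompletionMap (L := L) (IsCMField.complexConj L) hw)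
            (placeForm (Matrix.of fun i j : Fin 2 => if i.val + j.val + 1 = 2 then (1 : L) else 0) w.1)).subtype.comp eW.toMonoidHom with hφdef
  have hφe : ∀ g : (cmDatum L 2 (Matrix.of fun i j : Fin 2 => if i.val + j.val + 1 = 2 then (1 : L) else 0)).Local v, φ g = ((eW g : ↥(unitaryGroupOfForm (galAdicCompletionMap (L := L) (IsCMField.complexConj L) hw)
            (placeForm (Matrix.of fun i j : Fin 2 => if i.val + j.val + 1 = 2 then (1 : L) else 0) w.1))) : GL (Fin 2) E) := fun _ => rfl
  have hσv : ∀ x : E, valuation E (σ x) = valuation E x := fun x => valuation_galAdicCompletionMap_eq (IsCMField.complexConj L) v w hw x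
  haveI : IsDiscreteValuationRing 𝒪[E] := isDiscreteValuationRing_integer_of_compatible hϖ
  have hϖ' : IsUniformizingElement (ϖ : E) := isUniformizingElement_of_v_eq hϖ
  have hϖ0 : (ϖ : E) ≠ 0 := hϖ'.ne_zero
  have hσϖ0 : σ (ϖ : E) ≠ 0 := (map_ne_zero σ).2 hϖ0
  have hvϖ0 : valuation E (ϖ : E) ≠ 0 := (Valuation.ne_zero_iff _).2 hϖ0
  have hvϖ1 : valuation E (ϖ : E) ≠ 1 := hϖ'.valuation_lt_one.ne
  -- `IsRegularElt` is a class function on `U₂`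
  have hP : ∀ g x : (cmDatum L 2 (Matrix.of fun i j : Fin 2 => if i.val + j.val + 1 = 2 then (1 : L) else 0)).Local v, IsRegularElt (g.val : GL (Fin 2) (UnitaryGroup.LocalRing L v)) →
      IsRegularElt ((x * g * x⁻¹).val : GL (Fin 2) (UnitaryGroup.LocalRing L v)) := fun g x hg => isRegularElt_val_conj L 2 _ v g x hg
  -- (g-D): a regular DIAGONAL representative `δ` of the class of `γ`
  obtain ⟨g, dv, hd, h01', -⟩ := exists_conj_val_eq_glDiagonal_of_not_compactSpace_centralizer L v w hw γ hreg hnc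
  have hcl : ConjClasses.mk (g * γ * g⁻¹) = ConjClasses.mk γ := ConjClasses.mk_eq_mk_iff_isConj.2 (isConj_iff.2 ⟨g, rfl⟩).symm
  rw [← hcl]
  set δ : (cmDatum L 2 (Matrix.of fun i j : Fin 2 => if i.val + j.val + 1 = 2 then (1 : L) else 0)).Local v := g * γ * g⁻¹ with hδdef
  have hregδ : IsRegularElt (δ.val : GL (Fin 2) (UnitaryGroup.LocalRing L v)) := isRegularElt_val_conj L 2 _ v γ g hreg
  -- the one-place matrix of `δ` is the diagonal of the `w`-components of `dv`, with distinct entries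
  set d' : Fin 2 → E := fun i => ((dv i : UnitaryGroup.LocalRing L v)) w with hd'def
  have hδφ : ((φ δ : GL (Fin 2) E) : Matrix (Fin 2) (Fin 2) E) = diagonal d' := by
    rw [hφe]
    change ((δ.val : GL (Fin 2) (UnitaryGroup.LocalRing L v)) : Matrix (Fin 2) (Fin 2) (UnitaryGroup.LocalRing L v)).map
      (Pi.evalRingHom (fun w' : PlacesOver L v => w'.1.adicCompletion L) w) = diagonal d'
    rw [← hd, coe_glDiagonal, diagonal_map (map_zero _)]
    rfl
  have hd01 : d' 0 ≠ d' 1 := by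
    intro hEq
    apply h01'
    apply Units.ext
    funext w'
    obtain rfl : w' = w := Subsingleton.elim w' w
    exact hEq
  have hdist : ∀ i j : Fin 2, i ≠ j → IsUnit (d' i - d' j) := fun i j hij => by
    rw [isUnit_iff_ne_zero, sub_ne_zero]
    exact ne_apply_of_apply_zero_ne_apply_one hd01 i j hij
  -- the split-torus generator `τ = e_w⁻¹ diag(ϖ, (σ ϖ)⁻¹) ∈ Z(δ)` with (gen), (free)
  have hH := placeForm_antidiagTwo_eq_oneOne L w
  have hJ00 : placeForm (Matrix.of fun i j : Fin 2 => if i.val + j.val + 1 = 2 then (1 : L) else 0) w.1 0 0 = 0 := by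
    rw [hH]; rfl
  have hJ11 : placeForm (Matrix.of fun i j : Fin 2 => if i.val + j.val + 1 = 2 then (1 : L) else 0) w.1 1 1 = 0 := by
    rw [hH]; rfl
  have hJ01 : placeForm (Matrix.of fun i j : Fin 2 => if i.val + j.val + 1 = 2 then (1 : L) else 0) w.1 0 1 ≠ 0 := by
    rw [hH]; exact one_ne_zero
  -- (★ S4c, re-typed once from the `«local»` spelling of the carrier to `(cmDatum …).Local v`; ★ `cmDatum_Local` is `rfl`)
  obtain ⟨τ, hτφ, hgen, hfree⟩ :
      ∃ τ : Subgroup.centralizer ({δ} : Set ((cmDatum L 2 (Matrix.of fun i j : Fin 2 => if i.val + j.val + 1 = 2 then (1 : L) else 0)).Local v)),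
        ((φ (τ : (cmDatum L 2 (Matrix.of fun i j : Fin 2 => if i.val + j.val + 1 = 2 then (1 : L) else 0)).Local v) : GL (Fin 2) E) : Matrix (Fin 2) (Fin 2) E) = diagonal ![(ϖ : E), (σ (ϖ : E))⁻¹] ∧
        (∀ c' : Subgroup.centralizer ({δ} : Set ((cmDatum L 2 (Matrix.of fun i j : Fin 2 => if i.val + j.val + 1 = 2 then (1 : L) else 0)).Local v)), ∃ n : ℤ,
          c' * (τ ^ n)⁻¹ ∈ compactCore (Subgroup.centralizer ({δ} : Set ((cmDatum L 2 (Matrix.of fun i j : Fin 2 => if i.val + j.val + 1 = 2 then (1 : L) else 0)).Local v)))) ∧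
        (∀ n : ℤ, τ ^ n ∈ compactCore (Subgroup.centralizer ({δ} : Set ((cmDatum L 2 (Matrix.of fun i j : Fin 2 => if i.val + j.val + 1 = 2 then (1 : L) else 0)).Local v))) → n = 0) :=
    exists_splitTorus_generator_local_of_nonsplit (IsCMField.complexConj L) (Matrix.of fun i j : Fin 2 => if i.val + j.val + 1 = 2 then (1 : L) else 0) hc1 w hw
      hJ00 hJ11 hJ01 hϖ' hδφ hdist
  have hτmat : (((eW (τ : (cmDatum L 2 (Matrix.of fun i j : Fin 2 => if i.val + j.val + 1 = 2 then (1 : L) else 0)).Local v) : ↥(unitaryGroupOfForm (galAdicCompletionMap (L := L) (IsCMField.complexConj L) hw)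
            (placeForm (Matrix.of fun i j : Fin 2 => if i.val + j.val + 1 = 2 then (1 : L) else 0) w.1))) : GL (Fin 2) E) : Matrix (Fin 2) (Fin 2) E) =
      diagonal ![(ϖ : E), (σ (ϖ : E))⁻¹] := hτφ
  -- the compact-core facts, the closed class
  obtain ⟨hcomm, hcc, hco⟩ := compactCore_centralizer_local_facts_of_isRegularElt (IsCMField.complexConj L) 2 _ hc1
    (UnitaryGroup.antidiagOne_map_transpose (IsCMField.complexConj L) 2) (isUnit_antidiagOne_det L 2) δ hregδ
  have hO := isClosed_conjClass_local_of_isRegularElt L 2 (Matrix.of fun i j : Fin 2 => if i.val + j.val + 1 = 2 then (1 : L) else 0) v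
    (antidiagOne_isHermitian L 2) (isUnit_antidiagOne_det L 2).ne_zero δ hregδ
  /- the three tree-side torus facts at `x₀` -/
  -- valuations of diagonal entries on `Z(δ)`
  have ht : ∀ i : Fin 2, (![(ϖ : E), (σ (ϖ : E))⁻¹] : Fin 2 → E) i ≠ 0 := by
    rw [Fin.forall_fin_two]; exact ⟨hϖ0, inv_ne_zero hσϖ0⟩
  have hτv : ∀ i : Fin 2, valuation E (((φ (τ : (cmDatum L 2 (Matrix.of fun i j : Fin 2 => if i.val + j.val + 1 = 2 then (1 : L) else 0)).Local v) : GL (Fin 2) E) : Matrix (Fin 2) (Fin 2) E) i i) =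
      valuation E ((![(ϖ : E), (σ (ϖ : E))⁻¹] : Fin 2 → E) i) := fun i => by rw [hτφ, diagonal_apply_eq]
  have hτv0 : valuation E (((φ (τ : (cmDatum L 2 (Matrix.of fun i j : Fin 2 => if i.val + j.val + 1 = 2 then (1 : L) else 0)).Local v) : GL (Fin 2) E) : Matrix (Fin 2) (Fin 2) E) 0 0) = valuation E (ϖ : E) := by
    rw [hτv 0]; rfl
  -- (t2) `t_ϖ^n x₀ = x₀ ⇒ n = 0`
  have hfreeV : ∀ n : ℤ, act ((τ : (cmDatum L 2 (Matrix.of fun i j : Fin 2 => if i.val + j.val + 1 = 2 then (1 : L) else 0)).Local v) ^ n) x₀ = x₀ → n = 0 := by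
    intro n hn
    have hmem : ((τ ^ n : Subgroup.centralizer ({δ} : Set ((cmDatum L 2 (Matrix.of fun i j : Fin 2 => if i.val + j.val + 1 = 2 then (1 : L) else 0)).Local v))) : (cmDatum L 2 (Matrix.of fun i j : Fin 2 => if i.val + j.val + 1 = 2 then (1 : L) else 0)).Local v) ∈ Kv := by
      rw [hKv, SubgroupClass.coe_zpow]; exact hn
    have hdg : ∀ i j : Fin 2, i ≠ j →
        (((eW ((τ ^ n : Subgroup.centralizer ({δ} : Set ((cmDatum L 2 (Matrix.of fun i j : Fin 2 => if i.val + j.val + 1 = 2 then (1 : L) else 0)).Local v))) : (cmDatum L 2 (Matrix.of fun i j : Fin 2 => if i.val + j.val + 1 = 2 then (1 : L) else 0)).Local v) : ↥(unitaryGroupOfForm (galAdicCompletionMap (L := L) (IsCMField.complexConj L) hw)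
            (placeForm (Matrix.of fun i j : Fin 2 => if i.val + j.val + 1 = 2 then (1 : L) else 0) w.1))) : GL (Fin 2) E) : Matrix (Fin 2) (Fin 2) E) i j = 0 := by
      intro i j hij
      rw [← hφe, coe_apply_eq_diagonal_of_mem_centralizer w.1 φ hδφ hdist (τ ^ n).2, diagonal_apply_ne _ hij]
    have hint := (hdiag _ hdg).1 hmem
    rw [← hφe, mem_glInt_iff] at hint
    have h1 : valuation E (((φ ((τ ^ n : Subgroup.centralizer ({δ} : Set ((cmDatum L 2 (Matrix.of fun i j : Fin 2 => if i.val + j.val + 1 = 2 then (1 : L) else 0)).Local v))) : (cmDatum L 2 (Matrix.of fun i j : Fin 2 => if i.val + j.val + 1 = 2 then (1 : L) else 0)).Local v) : GL (Fin 2) E) : Matrix (Fin 2) (Fin 2) E) 0 0) ≤ 1 :=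
      (Valuation.mem_integer_iff _ _).1 (hint.1 0 0)
    have h2 : valuation E ((((φ ((τ ^ n : Subgroup.centralizer ({δ} : Set ((cmDatum L 2 (Matrix.of fun i j : Fin 2 => if i.val + j.val + 1 = 2 then (1 : L) else 0)).Local v))) : (cmDatum L 2 (Matrix.of fun i j : Fin 2 => if i.val + j.val + 1 = 2 then (1 : L) else 0)).Local v))⁻¹ : GL (Fin 2) E) : Matrix (Fin 2) (Fin 2) E) 0 0) ≤ 1 :=
      (Valuation.mem_integer_iff _ _).1 (hint.2 0 0)
    rw [valuation_apply_coe_zpow w.1 φ hδφ hdist τ n 0, hτv0] at h1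
    rw [← map_inv, ← Subgroup.coe_inv, ← _root_.zpow_neg, valuation_apply_coe_zpow w.1 φ hδφ hdist τ (-n) 0, hτv0, _root_.zpow_neg] at h2
    have hpos : 0 < valuation E (ϖ : E) ^ n := zpow_pos (lt_of_le_of_ne zero_le (Ne.symm hvϖ0)) n
    have h1' : valuation E (ϖ : E) ^ n = 1 := le_antisymm h1 ((inv_le_one₀ hpos).1 h2)
    exact (zpow_eq_one_iff_right₀ zero_le hvϖ1).1 h1'
  -- (t3) `δ x₀ = t_ϖ^k x₀`: rank one `|d'ᵢ| = |tᵢ|^k`, so `u₀ := t_ϖ^{-k} δ` is diagonal with unit entries, hence in `Kv`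
  obtain ⟨k, hk⟩ := exists_valuation_apply_eq_zpow σ hσv hϖ' hJ01 (eW (τ : (cmDatum L 2 (Matrix.of fun i j : Fin 2 => if i.val + j.val + 1 = 2 then (1 : L) else 0)).Local v)).2 hτφ rfl (eW δ).2 hδφ
  have hδZ : δ ∈ Subgroup.centralizer ({δ} : Set ((cmDatum L 2 (Matrix.of fun i j : Fin 2 => if i.val + j.val + 1 = 2 then (1 : L) else 0)).Local v)) := Subgroup.mem_centralizer_singleton_iff.2 rfl
  set u₀ : Subgroup.centralizer ({δ} : Set ((cmDatum L 2 (Matrix.of fun i j : Fin 2 => if i.val + j.val + 1 = 2 then (1 : L) else 0)).Local v)) := (τ ^ k)⁻¹ * ⟨δ, hδZ⟩ with hu₀def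
  have hu₀v : ∀ i : Fin 2, valuation E (((φ (u₀ : (cmDatum L 2 (Matrix.of fun i j : Fin 2 => if i.val + j.val + 1 = 2 then (1 : L) else 0)).Local v) : GL (Fin 2) E) : Matrix (Fin 2) (Fin 2) E) i i) = 1 := by
    intro i
    obtain ⟨ψ, hψ⟩ := exists_monoidHom_valuation_apply w.1 φ hδφ hdist i
    have hψτ : ψ τ = valuation E ((![(ϖ : E), (σ (ϖ : E))⁻¹] : Fin 2 → E) i) := by rw [hψ, hτv]
    have hψδ : ψ ⟨δ, hδZ⟩ = valuation E (d' i) := by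
      rw [hψ]
      change valuation E (((φ δ : GL (Fin 2) E) : Matrix (Fin 2) (Fin 2) E) i i) = valuation E (d' i)
      rw [hδφ, diagonal_apply_eq]
    have hψτ0 : ψ τ ≠ 0 := by rw [hψτ]; exact (Valuation.ne_zero_iff _).2 (ht i)
    rw [← hψ, hu₀def, map_mul, map_inv, map_zpow, hψτ, hψδ, hk i, ← hψτ, inv_mul_cancel₀ (zpow_ne_zero k hψτ0)]
  have hu₀dg : ∀ i j : Fin 2, i ≠ j →
      (((eW (u₀ : (cmDatum L 2 (Matrix.of fun i j : Fin 2 => if i.val + j.val + 1 = 2 then (1 : L) else 0)).Local v) : ↥(unitaryGroupOfForm (galAdicCompletionMap (L := L) (IsCMField.complexConj L) hw)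
            (placeForm (Matrix.of fun i j : Fin 2 => if i.val + j.val + 1 = 2 then (1 : L) else 0) w.1))) : GL (Fin 2) E) : Matrix (Fin 2) (Fin 2) E) i j = 0 := by
    intro i j hij
    rw [← hφe, coe_apply_eq_diagonal_of_mem_centralizer w.1 φ hδφ hdist u₀.2, diagonal_apply_ne _ hij]
  have hu₀K : (u₀ : (cmDatum L 2 (Matrix.of fun i j : Fin 2 => if i.val + j.val + 1 = 2 then (1 : L) else 0)).Local v) ∈ Kv := by
    refine (hdiag _ hu₀dg).2 ?_
    rw [← hφe]
    exact mem_glInt_of_diagonal_of_valuation_eq_one (fun i j hij => by rw [hφe]; exact hu₀dg i j hij) hu₀v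
  have hγτ : ∃ k : ℤ, act δ x₀ = act ((τ : (cmDatum L 2 (Matrix.of fun i j : Fin 2 => if i.val + j.val + 1 = 2 then (1 : L) else 0)).Local v) ^ k) x₀ := by
    refine ⟨k, ?_⟩
    have hδeq : δ = (τ : (cmDatum L 2 (Matrix.of fun i j : Fin 2 => if i.val + j.val + 1 = 2 then (1 : L) else 0)).Local v) ^ k * (u₀ : (cmDatum L 2 (Matrix.of fun i j : Fin 2 => if i.val + j.val + 1 = 2 then (1 : L) else 0)).Local v) := by
      rw [hu₀def, Subgroup.coe_mul, Subgroup.coe_inv, SubgroupClass.coe_zpow, mul_inv_cancel_left]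
    have h1 : act δ x₀ = act ((τ : (cmDatum L 2 (Matrix.of fun i j : Fin 2 => if i.val + j.val + 1 = 2 then (1 : L) else 0)).Local v) ^ k * (u₀ : (cmDatum L 2 (Matrix.of fun i j : Fin 2 => if i.val + j.val + 1 = 2 then (1 : L) else 0)).Local v)) x₀ := congrArg (fun y => act y x₀) hδeq
    rw [h1, act_mul, (hKv _).1 hu₀K]
  -- (t1) the step
  have hstepτ : X.Adj x₀ (act (τ : (cmDatum L 2 (Matrix.of fun i j : Fin 2 => if i.val + j.val + 1 = 2 then (1 : L) else 0)).Local v) x₀) := hstep _ hτmat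
  -- ★ THEOREM C at `δ`
  exact epCombination_classOrbitalIntegral_eq_zero_of_vertexAction hP hm hX act act_one act_mul act_adj h01 hV hD Kv Ke I hKv hKe hI
    hKvo hKvc hKeo hKec hIo hIc hregδ hO hcomm hcc hco τ hgen hfree hstepτ hfreeV hγτ


end Core

end Literature.NumberTheory.Rogawski1990

end
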